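import Literature.Probability.RandomPlanarGeometry.SAWPulledLargeForceExpansionZdWordTypesSixBlocks
import HarnessLib

/-!
# The fibre census of the cost-8 length-10 layer, cells part 2 of 8: masks 4–6 of 23

Topic `Literature/Probability/RandomPlanarGeometry` («ZD-FOUR-SLACK-TWO (B)», cells).  For each block mask `m` (the `sameLevel` table of a
group of height words of `FourSlackTwo.verts`), the seven kernel cells `cnt m k` (ROBUST form of `…ZdWordTypesSixBlocks`: nested raw-letter
fold, one `decide +kernel` per cell, ≈ 8 s each) and the census of the class for every `d` in falling-factorial form (`card_good_eq`).  The
masks are this file's tool notions (not notions in print); the tables `sameLevel_p_q_r` identify them with `FourSlackTwo.sameLevel (p,q,r)`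
on the nine even blocks for the listed height words.  No number is taken from print. [cite: MadrasSlade1993, §4.2, remark after Theorem 4.2.4 (p. 94)]

Provenance: lane «pcv-sawmu», a-p3 g18 (2026-08-25); expected values from the exact type enumerator `axistypes.py` (FINDING (22)).
-/

open Finset
open scoped BigOperators
open Literature.Probability.LatticeModels
open Literature.Probability.RandomPlanarGeometry.SAW

namespace Literature.Probability.RandomPlanarGeometry.SAW.Zd

namespace WordTypes

/-- The nine even blocks, as a list (for the mask tables of this part). [cite: MadrasSlade1993, Definition 1.2.4] -/
def nineBlocks2 : List (ℕ × ℕ) := [(0, 2), (1, 3), (2, 4), (3, 5), (4, 6), (0, 4), (1, 5), (2, 6), (0, 6)]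

/-- Mask 4: blocks [(0, 2), (0, 4), (0, 6), (1, 3), (1, 5), (2, 6), (3, 5)]. [cite: MadrasSlade1993, §4.2, remark after Theorem 4.2.4 (p. 94)] -/
def mask4 : ℕ → ℕ → Bool
  | 0, 2 => true
  | 0, 4 => true
  | 0, 6 => true
  | 1, 3 => true
  | 1, 5 => true
  | 2, 6 => true
  | 3, 5 => true
  | _, _ => false

/-- `sameLevel (1,5,8)` is mask 4 on the nine even blocks. [cite: MadrasSlade1993, §4.2, remark after Theorem 4.2.4 (p. 94)] -/
theorem sameLevel_1_5_8 : ∀ ij ∈ nineBlocks2, FourSlackTwo.sameLevel (1, 5, 8) ij.1 ij.2 = mask4 ij.1 ij.2 := by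
  decide +kernel

/-- Cell: mask 4, `k = 0` → 0. [cite: MadrasSlade1993, §4.2, remark after Theorem 4.2.4 (p. 94)] -/
theorem cnt_mask4_zero : cnt mask4 0 = 0 := by decide +kernel

/-- Cell: mask 4, `k = 1` → 4. [cite: MadrasSlade1993, §4.2, remark after Theorem 4.2.4 (p. 94)] -/
theorem cnt_mask4_one : cnt mask4 1 = 4 := by decide +kernel

/-- Cell: mask 4, `k = 2` → 628. [cite: MadrasSlade1993, §4.2, remark after Theorem 4.2.4 (p. 94)] -/
theorem cnt_mask4_two : cnt mask4 2 = 628 := by decide +kernel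

/-- Cell: mask 4, `k = 3` → 3264. [cite: MadrasSlade1993, §4.2, remark after Theorem 4.2.4 (p. 94)] -/
theorem cnt_mask4_three : cnt mask4 3 = 3264 := by decide +kernel

/-- Cell: mask 4, `k = 4` → 3168. [cite: MadrasSlade1993, §4.2, remark after Theorem 4.2.4 (p. 94)] -/
theorem cnt_mask4_four : cnt mask4 4 = 3168 := by decide +kernel

/-- Cell: mask 4, `k = 5` → 864. [cite: MadrasSlade1993, §4.2, remark after Theorem 4.2.4 (p. 94)] -/
theorem cnt_mask4_five : cnt mask4 5 = 864 := by decide +kernel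

/-- Cell: mask 4, `k = 6` → 64. [cite: MadrasSlade1993, §4.2, remark after Theorem 4.2.4 (p. 94)] -/
theorem cnt_mask4_six : cnt mask4 6 = 64 := by decide +kernel

/-- ★ Census of mask 4 for every `d` (1 height word(s) [(1, 5, 8)]): `n = [4, 628, 3264, 3168, 864, 64]` in `Σ_k n_k d^(k)`.
[cite: MadrasSlade1993, §4.2, remark after Theorem 4.2.4 (p. 94)] -/
theorem card_good_mask4 (d : ℕ) :
    (Finset.univ.filter fun u : Word 6 d => Good mask4 u).card = 4 * d.descFactorial 1 + 628 * d.descFactorial 2 + 3264 * d.descFactorial 3 + 3168 * d.descFactorial 4 + 864 * d.descFactorial 5 + 64 * d.descFactorial 6 := by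
  rw [card_good_eq]
  simp only [Finset.sum_range_succ, Finset.sum_range_zero, cnt_mask4_zero, cnt_mask4_one, cnt_mask4_two, cnt_mask4_three, cnt_mask4_four, cnt_mask4_five, cnt_mask4_six]
  ring

/-- Mask 5: blocks [(0, 2), (0, 4), (0, 6), (1, 3), (1, 5), (3, 5), (4, 6)]. [cite: MadrasSlade1993, §4.2, remark after Theorem 4.2.4 (p. 94)] -/
def mask5 : ℕ → ℕ → Bool
  | 0, 2 => true
  | 0, 4 => true
  | 0, 6 => true
  | 1, 3 => true
  | 1, 5 => true
  | 3, 5 => true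
  | 4, 6 => true
  | _, _ => false

/-- `sameLevel (1,3,6)` is mask 5 on the nine even blocks. [cite: MadrasSlade1993, §4.2, remark after Theorem 4.2.4 (p. 94)] -/
theorem sameLevel_1_3_6 : ∀ ij ∈ nineBlocks2, FourSlackTwo.sameLevel (1, 3, 6) ij.1 ij.2 = mask5 ij.1 ij.2 := by
  decide +kernel

/-- Cell: mask 5, `k = 0` → 0. [cite: MadrasSlade1993, §4.2, remark after Theorem 4.2.4 (p. 94)] -/
theorem cnt_mask5_zero : cnt mask5 0 = 0 := by decide +kernel

/-- Cell: mask 5, `k = 1` → 2. [cite: MadrasSlade1993, §4.2, remark after Theorem 4.2.4 (p. 94)] -/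
theorem cnt_mask5_one : cnt mask5 1 = 2 := by decide +kernel

/-- Cell: mask 5, `k = 2` → 512. [cite: MadrasSlade1993, §4.2, remark after Theorem 4.2.4 (p. 94)] -/
theorem cnt_mask5_two : cnt mask5 2 = 512 := by decide +kernel

/-- Cell: mask 5, `k = 3` → 2872. [cite: MadrasSlade1993, §4.2, remark after Theorem 4.2.4 (p. 94)] -/
theorem cnt_mask5_three : cnt mask5 3 = 2872 := by decide +kernel

/-- Cell: mask 5, `k = 4` → 2928. [cite: MadrasSlade1993, §4.2, remark after Theorem 4.2.4 (p. 94)] -/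
theorem cnt_mask5_four : cnt mask5 4 = 2928 := by decide +kernel

/-- Cell: mask 5, `k = 5` → 832. [cite: MadrasSlade1993, §4.2, remark after Theorem 4.2.4 (p. 94)] -/
theorem cnt_mask5_five : cnt mask5 5 = 832 := by decide +kernel

/-- Cell: mask 5, `k = 6` → 64. [cite: MadrasSlade1993, §4.2, remark after Theorem 4.2.4 (p. 94)] -/
theorem cnt_mask5_six : cnt mask5 6 = 64 := by decide +kernel

/-- ★ Census of mask 5 for every `d` (1 height word(s) [(1, 3, 6)]): `n = [2, 512, 2872, 2928, 832, 64]` in `Σ_k n_k d^(k)`.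
[cite: MadrasSlade1993, §4.2, remark after Theorem 4.2.4 (p. 94)] -/
theorem card_good_mask5 (d : ℕ) :
    (Finset.univ.filter fun u : Word 6 d => Good mask5 u).card = 2 * d.descFactorial 1 + 512 * d.descFactorial 2 + 2872 * d.descFactorial 3 + 2928 * d.descFactorial 4 + 832 * d.descFactorial 5 + 64 * d.descFactorial 6 := by
  rw [card_good_eq]
  simp only [Finset.sum_range_succ, Finset.sum_range_zero, cnt_mask5_zero, cnt_mask5_one, cnt_mask5_two, cnt_mask5_three, cnt_mask5_four, cnt_mask5_five, cnt_mask5_six]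
  ring

/-- Mask 6: blocks [(0, 2), (0, 4), (0, 6), (1, 3), (2, 4), (2, 6), (4, 6)]. [cite: MadrasSlade1993, §4.2, remark after Theorem 4.2.4 (p. 94)] -/
def mask6 : ℕ → ℕ → Bool
  | 0, 2 => true
  | 0, 4 => true
  | 0, 6 => true
  | 1, 3 => true
  | 2, 4 => true
  | 2, 6 => true
  | 4, 6 => true
  | _, _ => false

/-- `sameLevel (1,6,9)` is mask 6 on the nine even blocks. [cite: MadrasSlade1993, §4.2, remark after Theorem 4.2.4 (p. 94)] -/
theorem sameLevel_1_6_9 : ∀ ij ∈ nineBlocks2, FourSlackTwo.sameLevel (1, 6, 9) ij.1 ij.2 = mask6 ij.1 ij.2 := by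
  decide +kernel

/-- Cell: mask 6, `k = 0` → 0. [cite: MadrasSlade1993, §4.2, remark after Theorem 4.2.4 (p. 94)] -/
theorem cnt_mask6_zero : cnt mask6 0 = 0 := by decide +kernel

/-- Cell: mask 6, `k = 1` → 2. [cite: MadrasSlade1993, §4.2, remark after Theorem 4.2.4 (p. 94)] -/
theorem cnt_mask6_one : cnt mask6 1 = 2 := by decide +kernel

/-- Cell: mask 6, `k = 2` → 488. [cite: MadrasSlade1993, §4.2, remark after Theorem 4.2.4 (p. 94)] -/
theorem cnt_mask6_two : cnt mask6 2 = 488 := by decide +kernel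

/-- Cell: mask 6, `k = 3` → 2848. [cite: MadrasSlade1993, §4.2, remark after Theorem 4.2.4 (p. 94)] -/
theorem cnt_mask6_three : cnt mask6 3 = 2848 := by decide +kernel

/-- Cell: mask 6, `k = 4` → 2928. [cite: MadrasSlade1993, §4.2, remark after Theorem 4.2.4 (p. 94)] -/
theorem cnt_mask6_four : cnt mask6 4 = 2928 := by decide +kernel

/-- Cell: mask 6, `k = 5` → 832. [cite: MadrasSlade1993, §4.2, remark after Theorem 4.2.4 (p. 94)] -/
theorem cnt_mask6_five : cnt mask6 5 = 832 := by decide +kernel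

/-- Cell: mask 6, `k = 6` → 64. [cite: MadrasSlade1993, §4.2, remark after Theorem 4.2.4 (p. 94)] -/
theorem cnt_mask6_six : cnt mask6 6 = 64 := by decide +kernel

/-- ★ Census of mask 6 for every `d` (1 height word(s) [(1, 6, 9)]): `n = [2, 488, 2848, 2928, 832, 64]` in `Σ_k n_k d^(k)`.
[cite: MadrasSlade1993, §4.2, remark after Theorem 4.2.4 (p. 94)] -/
theorem card_good_mask6 (d : ℕ) :
    (Finset.univ.filter fun u : Word 6 d => Good mask6 u).card = 2 * d.descFactorial 1 + 488 * d.descFactorial 2 + 2848 * d.descFactorial 3 + 2928 * d.descFactorial 4 + 832 * d.descFactorial 5 + 64 * d.descFactorial 6 := by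
  rw [card_good_eq]
  simp only [Finset.sum_range_succ, Finset.sum_range_zero, cnt_mask6_zero, cnt_mask6_one, cnt_mask6_two, cnt_mask6_three, cnt_mask6_four, cnt_mask6_five, cnt_mask6_six]
  ring

end WordTypes

end Literature.Probability.RandomPlanarGeometry.SAW.Zd
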